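import Literature.MathematicalPhysics.QuantumFieldTheory.ConformalBootstrap3D.PointKernelK34L505Data
import Literature.MathematicalPhysics.QuantumFieldTheory.ConformalBootstrap3D.PointKernelK34L505Segs
import Literature.MathematicalPhysics.QuantumFieldTheory.ConformalBootstrap3D.PointKernelParts

/-!
# K34L505 certificate, kernel part file P30: one-cell head segments 98, 99 in level ranges

The head cells whose kernel evaluation exceeds one `decide` are one-cell segments of `hsegsK34L505`; each is
checked by `PCert.hPartSideOK` (side conditions) and `PCert.hPartOK` per level range `[n_lo, n_lo + count)`
against an integer claim, the claims summing to `≥ 0` (`PointKernel.partsOK`); soundness is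
`PCert.hParts_sound` (`PointKernelParts`).  The part files are mutually independent (each imports only
the data file); the ranges of one cell may span several of them, and the per-cell conclusions
`hparts_i` / `hcell_i` of those cells are assembled in `PointKernelK34L505.lean`.
Estimated kernel time 242 s.
-/

set_option maxRecDepth 100000
set_option maxHeartbeats 0

namespace Literature.MathematicalPhysics.QuantumFieldTheory.ConformalBootstrap3D.PointKernelK34L505

open Literature.MathematicalPhysics.QuantumFieldTheory.ConformalBootstrap3D.PointKernel

/-- levels `[49, 56)` of segment 98: partial lower sum `≥` claim. [folklore] -/
theorem part_98_3 : certK34L505.hPartOK (PCert.segAt hsegsK34L505 98) JHK34L505 49 7 (1387805219527256631850551612189130389) = true := by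
  decide +kernel

/-- levels `[56, 61)` of segment 98: partial lower sum `≥` claim. [folklore] -/
theorem part_98_4 : certK34L505.hPartOK (PCert.segAt hsegsK34L505 98) JHK34L505 56 5 (500197454327343225357793855062619137) = true := by
  decide +kernel

/-- levels `[61, 65)` of segment 98: partial lower sum `≥` claim. [folklore] -/
theorem part_98_5 : certK34L505.hPartOK (PCert.segAt hsegsK34L505 98) JHK34L505 61 4 (237763344545081471116220137340964435) = true := by
  decide +kernel

/-- one-cell segment 99 (row 6, cell `[28677/4096, 14339/2048]`, chord, `n_F = 64`,
6 level ranges): side conditions. [folklore] -/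
theorem pside_99 : certK34L505.hPartSideOK (PCert.segAt hsegsK34L505 99) JHK34L505 = true := by
  decide +kernel

/-- its level ranges `(n_lo, count, claim)`. [folklore] -/
def partsK34L505_99 : List (ℕ × ℕ × ℤ) := [(0, 28, -22102001739164266145410804560103294771), (28, 12, 15734332744874222955788572724491645967), (40, 9, 4281649312278463711633740925355018438), (49, 7, 1374663035722087020785276566307876697), (56, 5, 486916202246036931588235126282208620), (61, 4, 224440444043455525614979217666545051)]

/-- the ranges tile `[0, n_F]` and the claims sum to `≥ 0`. [folklore] -/
theorem pcov_99 : PointKernel.partsOK 64 partsK34L505_99 = true := by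
  decide +kernel

/-- levels `[0, 28)` of segment 99: partial lower sum `≥` claim. [folklore] -/
theorem part_99_0 : certK34L505.hPartOK (PCert.segAt hsegsK34L505 99) JHK34L505 0 28 (-22102001739164266145410804560103294771) = true := by
  decide +kernel

end Literature.MathematicalPhysics.QuantumFieldTheory.ConformalBootstrap3D.PointKernelK34L505
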